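import Mathlib
import Summits.NavierStokesRegularity.NavierStokesRegularity.Theorems.TypeIIInviscidRelaxationCoreExclusionAnchorReduction
import HarnessLib

/-!
# Crux `ColumnarCoreExclusion` (stmt-1966), line `columnar_comparison_flow`: the core radius of a columnar witness
# near the blow-up time is bounded by the far-field radius, so LATE columnar witnesses obey an EULER-RATE CEILING

`--supports stmt-NavierStokesRegularity-1966` (helper file; theorems only, no definitions, no `sorry`).

Context.  The open [L] anchor stub `stub_anchoredLateColumnarWitness` asks, for every level `K`, for a level-`K`
columnar witness `(t, x₀, L, V, Q, W)` that is LATE, `(T - t)·V ≤ K·L`, and anchored at a singular point.  Hands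
6-g2/6-g3 reduced it to «lateness + core-radius floor» (`anchoredLateWitness_of_lateWitnesses_radiusFloor`) and to
«lateness + Euler-rate FLOOR `(T - t)‖u(t)‖∞ ≥ r₀`» (`anchoredLateWitness_of_lateWitnesses_eulerRate`), and showed by
kinematic families that the crux hypothesis `hw` alone forces none of these.  This file adds the converse structural
constraint, which is specific to the COLUMNAR class and uses two dynamical facts of the tree (Leray's lower blow-up
rate, the Kato far-field bound):

* `norm_sub_le_on_axialSegment`, `norm_ge_on_axialSegment` — KINEMATICS of a level-`K` columnar datum: along the
  axial segment `x₁ + (Lτ)·Q e_z`, `|τ| ≤ K - 1`, through the near-maximum point `x₁` the slice stays `2V/K`-close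
  to `u(x₁)`, hence has speed `≥ V/2 - 2V/K` (`≥ V/4` for `K ≥ 8`).
* `coreRadius_le_of_farField` — if the slice is bounded by `M` outside the ball `‖x‖ ≤ R` and `4M < V`, then the
  whole segment lies in that ball, so `(K - 1)·L ≤ R`: THE CORE RADIUS OF A COLUMNAR WITNESS IS AT MOST THE
  FAR-FIELD RADIUS.
* `exists_coreRadius_bound_near_blowup` — for a maximal smooth Leray–Hopf solution from a rapidly decaying datum
  there are `R` and `t₁ < T` such that EVERY level-`K ≥ 8` columnar witness at a time `t ∈ (t₁, T)` has
  `(K - 1)·L ≤ R` (Leray's rate makes `V > 4M` near `T`; Kato's far field supplies `R`, `M`).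
* `eulerCeiling_of_late_columnarWitness` — consequently a LATE level-`K ≥ 8` columnar witness at `t ∈ (t₁, T)`
  has `(T - t)·V ≤ 2R`: late columnar witnesses exist only at times where the speed maximum is at most of EULER
  RATE, `‖u(t)‖∞ ≤ V ≤ 2R/(T - t)`.
* `no_late_columnarWitness_at_superEuler_time` — at a time `t ∈ (t₁, T)` with `(T - t)‖u(t,x)‖ > 2R` for some
  `x` (a super-Euler excursion) there is NO late level-`K ≥ 8` columnar witness at all.

Reading for the planner (honest framing).  Together with 6-g3's floor theorem, the late-anchored regime of the
columnar anchor stub is pinned to Euler-rate witness times, `r₀ ≤ (T - t)·V ≤ 2R_far`; a blow-up with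
`(T - t)‖u(t)‖∞ → ∞` can serve the stub's conclusion at high levels only at early times.  No such bound holds for
the axisymmetric class (ring / monopole cores have extent `~ L`, not `~ K·L`).  Nothing here proves or refutes a
stub, the crux, or Navier–Stokes regularity; rung 0.
-/

noncomputable section

open Set Metric Function
open Literature.Analysis Literature.Analysis.FluidPDE

namespace Summit.NavierStokesRegularity.NavierStokesRegularity.Theorems

-- the problem directory repeats the summit name (`NavierStokesRegularity/NavierStokesRegularity`)
set_option linter.dupNamespace false

namespace ColumnarCoreExtent

/-- The axial unit vector has norm one (file-local copy). [folklore] -/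
private theorem norm_eZ : ‖(eZ : EuclideanSpace ℝ (Fin 3))‖ = 1 := by
  simp [eZ]

/-! ## Kinematics of a columnar datum along the axial segment through the near-maximum point -/

/-- **Axial coherence of a columnar datum.**  If the slice `u`, recentred at `x₀`, rotated by `Q` and rescaled by
`L`, `V`, is `K⁻¹`-close on `‖y‖ ≤ K` to a COLUMNAR profile `W`, and `dist x₁ x₀ ≤ L`, then along the axial segment
through `x₁`, `‖u(x₁ + (Lτ)·Q e_z) - u(x₁)‖ ≤ 2V/K` for `|τ| ≤ K - 1` (both points have rescaled positions of norm
`≤ K` with the same horizontal part, where `W` takes the same value). [folklore] -/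
theorem norm_sub_le_on_axialSegment
    {u : EuclideanSpace ℝ (Fin 3) → EuclideanSpace ℝ (Fin 3)} {x₀ x₁ : EuclideanSpace ℝ (Fin 3)} {L V K : ℝ}
    {Q : EuclideanSpace ℝ (Fin 3) ≃ₗᵢ[ℝ] EuclideanSpace ℝ (Fin 3)}
    {W : EuclideanSpace ℝ (Fin 3) → EuclideanSpace ℝ (Fin 3)}
    (hL : 0 < L) (hV : 0 < V) (hK : 1 ≤ K) (hcol : IsColumnar W) (hx₁ : dist x₁ x₀ ≤ L)
    (hclose : ∀ y : EuclideanSpace ℝ (Fin 3), ‖y‖ ≤ K → ‖V⁻¹ • Q.symm (u (x₀ + L • Q y)) - W y‖ ≤ K⁻¹)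
    {τ : ℝ} (hτ : |τ| ≤ K - 1) :
    ‖u (x₁ + (L * τ) • Q eZ) - u x₁‖ ≤ 2 * V / K := by
  -- rescaled position of `x₁` (kept opaque)
  obtain ⟨y₁, hy₁⟩ : ∃ y : EuclideanSpace ℝ (Fin 3), y = L⁻¹ • Q.symm (x₁ - x₀) := ⟨_, rfl⟩
  have hy₁n : ‖y₁‖ ≤ 1 := by
    rw [hy₁, norm_smul, norm_inv, Real.norm_of_nonneg hL.le, LinearIsometryEquiv.norm_map, ← dist_eq_norm,
      inv_mul_le_iff₀ hL, mul_one]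
    exact hx₁
  have hx₁eq : x₀ + L • Q y₁ = x₁ := by
    rw [hy₁, map_smul, LinearIsometryEquiv.apply_symm_apply, smul_smul, mul_inv_cancel₀ hL.ne', one_smul]
    abel
  have hPeq : x₀ + L • Q (y₁ + τ • eZ) = x₁ + (L * τ) • Q eZ := by
    rw [map_add, map_smul, smul_add, ← add_assoc, hx₁eq, smul_smul]
  have hyτ : ‖y₁ + τ • eZ‖ ≤ K := by
    calc ‖y₁ + τ • eZ‖ ≤ ‖y₁‖ + ‖τ • eZ‖ := norm_add_le _ _
      _ = ‖y₁‖ + |τ| := by rw [norm_smul, norm_eZ, mul_one, Real.norm_eq_abs]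
      _ ≤ 1 + (K - 1) := add_le_add hy₁n hτ
      _ = K := by ring
  have h1 := hclose (y₁ + τ • eZ) hyτ
  have h2 := hclose y₁ (hy₁n.trans hK)
  rw [hPeq, hcol y₁ τ] at h1
  rw [hx₁eq] at h2
  have key : V⁻¹ * ‖u (x₁ + (L * τ) • Q eZ) - u x₁‖ ≤ K⁻¹ + K⁻¹ := by
    calc V⁻¹ * ‖u (x₁ + (L * τ) • Q eZ) - u x₁‖
        = ‖V⁻¹ • Q.symm (u (x₁ + (L * τ) • Q eZ) - u x₁)‖ := by
          rw [norm_smul, norm_inv, Real.norm_of_nonneg hV.le, LinearIsometryEquiv.norm_map]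
      _ = ‖(V⁻¹ • Q.symm (u (x₁ + (L * τ) • Q eZ)) - W y₁) - (V⁻¹ • Q.symm (u x₁) - W y₁)‖ := by
          rw [sub_sub_sub_cancel_right, ← smul_sub, ← map_sub]
      _ ≤ ‖V⁻¹ • Q.symm (u (x₁ + (L * τ) • Q eZ)) - W y₁‖ + ‖V⁻¹ • Q.symm (u x₁) - W y₁‖ :=
          norm_sub_le _ _
      _ ≤ K⁻¹ + K⁻¹ := add_le_add h1 h2
  rw [inv_mul_le_iff₀ hV] at key
  calc ‖u (x₁ + (L * τ) • Q eZ) - u x₁‖ ≤ V * (K⁻¹ + K⁻¹) := key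
    _ = 2 * V / K := by ring

/-- **Speed floor along the axial segment.**  Under the same closeness, if moreover `x₁` is a near-maximum point,
`V ≤ 2‖u x₁‖`, then `‖u(x₁ + (Lτ)·Q e_z)‖ ≥ V/2 - 2V/K` for `|τ| ≤ K - 1`. [folklore] -/
theorem norm_ge_on_axialSegment
    {u : EuclideanSpace ℝ (Fin 3) → EuclideanSpace ℝ (Fin 3)} {x₀ x₁ : EuclideanSpace ℝ (Fin 3)} {L V K : ℝ}
    {Q : EuclideanSpace ℝ (Fin 3) ≃ₗᵢ[ℝ] EuclideanSpace ℝ (Fin 3)}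
    {W : EuclideanSpace ℝ (Fin 3) → EuclideanSpace ℝ (Fin 3)}
    (hL : 0 < L) (hV : 0 < V) (hK : 1 ≤ K) (hcol : IsColumnar W) (hx₁ : dist x₁ x₀ ≤ L)
    (hmax : V ≤ 2 * ‖u x₁‖)
    (hclose : ∀ y : EuclideanSpace ℝ (Fin 3), ‖y‖ ≤ K → ‖V⁻¹ • Q.symm (u (x₀ + L • Q y)) - W y‖ ≤ K⁻¹)
    {τ : ℝ} (hτ : |τ| ≤ K - 1) :
    V / 2 - 2 * V / K ≤ ‖u (x₁ + (L * τ) • Q eZ)‖ := by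
  have h := norm_sub_le_on_axialSegment hL hV hK hcol hx₁ hclose hτ
  have h' : ‖u x₁‖ - ‖u (x₁ + (L * τ) • Q eZ)‖ ≤ 2 * V / K :=
    (norm_sub_norm_le _ _).trans (by rwa [norm_sub_rev])
  linarith

/-- **The core radius of a columnar witness is at most the far-field radius.**  If the slice `u` is bounded by `M`
outside the ball `‖x‖ ≤ R`, carries a level-`K ≥ 8` columnar datum `(x₀, L, V, Q, W)` with a near-maximum point
`x₁`, `dist x₁ x₀ ≤ L`, `V ≤ 2‖u x₁‖`, and `4M < V`, then `(K - 1)·L ≤ R`: the two ends `x₁ ± L(K-1)·Q e_z` of the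
axial segment carry speed `≥ V/4 > M`, so both lie in the ball, and they are `2(K-1)L` apart. [folklore] -/
theorem coreRadius_le_of_farField
    {u : EuclideanSpace ℝ (Fin 3) → EuclideanSpace ℝ (Fin 3)} {x₀ x₁ : EuclideanSpace ℝ (Fin 3)} {L V K R M : ℝ}
    {Q : EuclideanSpace ℝ (Fin 3) ≃ₗᵢ[ℝ] EuclideanSpace ℝ (Fin 3)}
    {W : EuclideanSpace ℝ (Fin 3) → EuclideanSpace ℝ (Fin 3)}
    (hL : 0 < L) (hV : 0 < V) (hK : 8 ≤ K) (hcol : IsColumnar W) (hx₁ : dist x₁ x₀ ≤ L)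
    (hmax : V ≤ 2 * ‖u x₁‖)
    (hclose : ∀ y : EuclideanSpace ℝ (Fin 3), ‖y‖ ≤ K → ‖V⁻¹ • Q.symm (u (x₀ + L • Q y)) - W y‖ ≤ K⁻¹)
    (hfar : ∀ x : EuclideanSpace ℝ (Fin 3), R < ‖x‖ → ‖u x‖ ≤ M) (hMV : 4 * M < V) :
    (K - 1) * L ≤ R := by
  have hK1 : 1 ≤ K := by linarith
  -- speed floor `V/4` at the two ends of the segment
  have hVK : 2 * V / K ≤ V / 4 := by
    have h : 2 * V / K ≤ 2 * V / 8 := div_le_div_of_nonneg_left (by positivity) (by norm_num) hK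
    linarith
  have hin : ∀ τ : ℝ, |τ| ≤ K - 1 → ‖x₁ + (L * τ) • Q eZ‖ ≤ R := by
    intro τ hτ
    by_contra hout
    have hge := norm_ge_on_axialSegment hL hV hK1 hcol hx₁ hmax hclose hτ
    have hle := hfar _ (lt_of_not_ge hout)
    linarith
  have hτp : |K - 1| ≤ K - 1 := (abs_of_nonneg (by linarith)).le
  have hτm : |-(K - 1)| ≤ K - 1 := by rw [abs_neg]; exact hτp
  have hp := hin (K - 1) hτp
  have hm := hin (-(K - 1)) hτm
  -- the two ends are `2(K-1)L` apart
  have hdiff : (x₁ + (L * (K - 1)) • Q eZ) - (x₁ + (L * -(K - 1)) • Q eZ) = (2 * ((K - 1) * L)) • Q eZ := by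
    rw [add_sub_add_left_eq_sub, ← sub_smul]
    congr 1
    ring
  have hnorm : ‖(x₁ + (L * (K - 1)) • Q eZ) - (x₁ + (L * -(K - 1)) • Q eZ)‖ = 2 * ((K - 1) * L) := by
    rw [hdiff, norm_smul, LinearIsometryEquiv.norm_map, norm_eZ, mul_one, Real.norm_of_nonneg]
    nlinarith
  have htri : ‖(x₁ + (L * (K - 1)) • Q eZ) - (x₁ + (L * -(K - 1)) • Q eZ)‖ ≤ R + R :=
    (norm_sub_le _ _).trans (add_le_add hp hm)
  rw [hnorm] at htri
  linarith

/-! ## Near the blow-up time: Leray's rate and Kato's far field -/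

/-- **Columnar cores near the blow-up time have bounded radius.**  For a maximal smooth solution on `[0,T)`,
Leray–Hopf from a rapidly decaying datum, there are `R` and `0 ≤ t₁ < T` such that every level-`K ≥ 8` columnar
datum (speed bound `V` attained within factor `2` at `x₁`, `dist x₁ x₀ ≤ L`, `K⁻¹`-closeness on `‖y‖ ≤ K` to a
columnar profile) at a time `t ∈ (t₁, T)` has `(K - 1)·L ≤ R`.  Proof: Kato's far-field bound
(`exists_farField_norm_le`: `‖u‖ ≤ M` on `(T-δ,T) × {‖x‖ > R}`) and Leray's lower rate
(`exists_leray_const_of_speedBound`: `V ≥ c₀√ν/√(T-t)`, so `V > 4(|M|+1)` once `T - t < c₀²ν/(16(|M|+1)²)`), then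
`coreRadius_le_of_farField`. [cite: Leray1934, §20 (3.13) p. 224] -/
theorem exists_coreRadius_bound_near_blowup {ν T : ℝ}
    {u : ℝ → EuclideanSpace ℝ (Fin 3) → EuclideanSpace ℝ (Fin 3)} {p : ℝ → EuclideanSpace ℝ (Fin 3) → ℝ}
    (hν : 0 < ν) (hT : 0 < T) (hmax : IsMaximalSmoothSolution ν 0 u p T)
    (hLH : IsLerayHopfOn T ν 0 (u 0) u) (hdec : HasRapidSpatialDecay (u 0)) :
    ∃ R t₁ : ℝ, 0 ≤ t₁ ∧ t₁ < T ∧ ∀ t ∈ Ioo t₁ T, ∀ K : ℝ, 8 ≤ K →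
      ∀ (x₀ : EuclideanSpace ℝ (Fin 3)) (L V : ℝ)
        (Q : EuclideanSpace ℝ (Fin 3) ≃ₗᵢ[ℝ] EuclideanSpace ℝ (Fin 3))
        (W : EuclideanSpace ℝ (Fin 3) → EuclideanSpace ℝ (Fin 3)),
        0 < L → 0 < V → IsColumnar W → (∀ x, ‖u t x‖ ≤ V) →
        (∃ x₁, dist x₁ x₀ ≤ L ∧ V ≤ 2 * ‖u t x₁‖) →
        (∀ y : EuclideanSpace ℝ (Fin 3), ‖y‖ ≤ K →
          ‖V⁻¹ • Q.symm (u t (x₀ + L • Q y)) - W y‖ ≤ K⁻¹) →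
        (K - 1) * L ≤ R := by
  obtain ⟨δ, R, M, hδ, hfar⟩ := CoreExclusionAnchor.exists_farField_norm_le hν hT hmax.1 hLH hdec
  obtain ⟨c₀, hc₀, hler⟩ := CoreExclusionAnchor.exists_leray_const_of_speedBound hν hT hmax hLH hdec
  set M₁ : ℝ := |M| + 1 with hM₁_def
  have hM₁ : 0 < M₁ := by positivity
  have hMM₁ : M ≤ M₁ := (le_abs_self M).trans (by linarith)
  set ε : ℝ := c₀ ^ 2 * ν / (16 * M₁ ^ 2) with hε_def
  have hε : 0 < ε := by positivity
  set t₁ : ℝ := max (max (T - δ) 0) (T - ε) with ht₁_def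
  have ht₁0 : 0 ≤ t₁ := (le_max_right _ _).trans (le_max_left _ _)
  have ht₁T : t₁ < T := max_lt (max_lt (by linarith) hT) (by linarith)
  refine ⟨R, t₁, ht₁0, ht₁T, ?_⟩
  intro t ht K hK x₀ L V Q W hL hV hcol hbd hnear hclose
  obtain ⟨x₁, hx₁, hmx⟩ := hnear
  have htδ : T - δ < t := (le_max_left _ _).trans_lt ((le_max_left _ _).trans_lt ht.1)
  have ht0 : 0 < t := (le_max_right _ _).trans_lt ((le_max_left _ _).trans_lt ht.1)
  have htε : T - t < ε := by linarith [(le_max_right _ _ : T - ε ≤ t₁), ht.1]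
  have hTt : 0 < T - t := sub_pos.2 ht.2
  -- Leray: `V ≥ c₀√ν/√(T-t) > 4M₁`
  have hV1 : c₀ * Real.sqrt ν / Real.sqrt (T - t) ≤ V := hler t ⟨ht0.le, ht.2⟩ V hbd
  have hsq : Real.sqrt ε = c₀ * Real.sqrt ν / (4 * M₁) := by
    have h4 : 0 ≤ c₀ * Real.sqrt ν / (4 * M₁) := by positivity
    rw [← Real.sqrt_sq h4]
    congr 1
    rw [hε_def, div_pow, mul_pow, Real.sq_sqrt hν.le]
    ring
  have hroot : Real.sqrt (T - t) < c₀ * Real.sqrt ν / (4 * M₁) := by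
    rw [← hsq]
    exact Real.sqrt_lt_sqrt hTt.le htε
  have hnum : 0 < c₀ * Real.sqrt ν := mul_pos hc₀ (Real.sqrt_pos.2 hν)
  have hV2 : 4 * M₁ < c₀ * Real.sqrt ν / Real.sqrt (T - t) := by
    have h := div_lt_div_of_pos_left hnum (Real.sqrt_pos.2 hTt) hroot
    have e : c₀ * Real.sqrt ν / (c₀ * Real.sqrt ν / (4 * M₁)) = 4 * M₁ := by
      field_simp
    rwa [e] at h
  have hMV : 4 * M₁ < V := hV2.trans_le hV1
  -- far field at time `t`
  have hfar_t : ∀ x : EuclideanSpace ℝ (Fin 3), R < ‖x‖ → ‖u t x‖ ≤ M₁ :=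
    fun x hx => (hfar t htδ ht0 ht.2 x hx).trans hMM₁
  exact coreRadius_le_of_farField hL hV hK hcol hx₁ hmx hclose hfar_t hMV

/-- **Euler-rate ceiling at late columnar witness times.**  With `R`, `t₁` as in
`exists_coreRadius_bound_near_blowup`: a LATE level-`K ≥ 8` columnar witness at `t ∈ (t₁, T)` —
`(T - t)·V ≤ K·L` — has `(T - t)·V ≤ 2R` (since `K·L = (K-1)·L + L ≤ 2(K-1)·L ≤ 2R`); in particular the speed
maximum at such a time is at most of Euler rate, `‖u(t)‖∞ ≤ V ≤ 2R/(T - t)`. [folklore] -/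
theorem eulerCeiling_of_late_columnarWitness {ν T : ℝ}
    {u : ℝ → EuclideanSpace ℝ (Fin 3) → EuclideanSpace ℝ (Fin 3)} {p : ℝ → EuclideanSpace ℝ (Fin 3) → ℝ}
    (hν : 0 < ν) (hT : 0 < T) (hmax : IsMaximalSmoothSolution ν 0 u p T)
    (hLH : IsLerayHopfOn T ν 0 (u 0) u) (hdec : HasRapidSpatialDecay (u 0)) :
    ∃ R t₁ : ℝ, 0 ≤ t₁ ∧ t₁ < T ∧ ∀ t ∈ Ioo t₁ T, ∀ K : ℝ, 8 ≤ K →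
      ∀ (x₀ : EuclideanSpace ℝ (Fin 3)) (L V : ℝ)
        (Q : EuclideanSpace ℝ (Fin 3) ≃ₗᵢ[ℝ] EuclideanSpace ℝ (Fin 3))
        (W : EuclideanSpace ℝ (Fin 3) → EuclideanSpace ℝ (Fin 3)),
        0 < L → 0 < V → IsColumnar W → (∀ x, ‖u t x‖ ≤ V) →
        (∃ x₁, dist x₁ x₀ ≤ L ∧ V ≤ 2 * ‖u t x₁‖) →
        (∀ y : EuclideanSpace ℝ (Fin 3), ‖y‖ ≤ K →
          ‖V⁻¹ • Q.symm (u t (x₀ + L • Q y)) - W y‖ ≤ K⁻¹) →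
        (T - t) * V ≤ K * L → (T - t) * V ≤ 2 * R := by
  obtain ⟨R, t₁, ht₁0, ht₁T, hcore⟩ := exists_coreRadius_bound_near_blowup hν hT hmax hLH hdec
  refine ⟨R, t₁, ht₁0, ht₁T, ?_⟩
  intro t ht K hK x₀ L V Q W hL hV hcol hbd hnear hclose hlate
  have h := hcore t ht K hK x₀ L V Q W hL hV hcol hbd hnear hclose
  have hL' : L ≤ (K - 1) * L := by nlinarith
  nlinarith

/-- **No late columnar witness at a super-Euler time.**  With `R`, `t₁` as above: if at a time `t ∈ (t₁, T)` the
solution has a super-Euler excursion `(T - t)·‖u(t,x)‖ > 2R` at some point `x`, then `u(t)` admits NO late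
level-`K` columnar witness for any `K ≥ 8` (all clauses of `TypeIICoreWitness IsColumnar ν K u t` plus lateness
`(T - t)·V ≤ K·L`).  So the conclusion of the registered anchor stub `stub_anchoredLateColumnarWitness` can be served
at levels `K ≥ 8` only by times `t ≤ t₁` or by Euler-ceiling times `(T - t)‖u(t)‖∞ ≤ 2R`. [folklore] -/
theorem no_late_columnarWitness_at_superEuler_time {ν T : ℝ}
    {u : ℝ → EuclideanSpace ℝ (Fin 3) → EuclideanSpace ℝ (Fin 3)} {p : ℝ → EuclideanSpace ℝ (Fin 3) → ℝ}
    (hν : 0 < ν) (hT : 0 < T) (hmax : IsMaximalSmoothSolution ν 0 u p T)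
    (hLH : IsLerayHopfOn T ν 0 (u 0) u) (hdec : HasRapidSpatialDecay (u 0)) :
    ∃ R t₁ : ℝ, 0 ≤ t₁ ∧ t₁ < T ∧ ∀ t ∈ Ioo t₁ T,
      (∃ x : EuclideanSpace ℝ (Fin 3), 2 * R < (T - t) * ‖u t x‖) → ∀ K : ℝ, 8 ≤ K →
      ¬ ∃ (x₀ : EuclideanSpace ℝ (Fin 3)) (L V : ℝ)
          (Q : EuclideanSpace ℝ (Fin 3) ≃ₗᵢ[ℝ] EuclideanSpace ℝ (Fin 3))
          (W : EuclideanSpace ℝ (Fin 3) → EuclideanSpace ℝ (Fin 3)),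
          0 < L ∧ 0 < V ∧ IsColumnar W ∧ (∀ x, ‖u t x‖ ≤ V) ∧
          (∃ x₁, dist x₁ x₀ ≤ L ∧ V ≤ 2 * ‖u t x₁‖) ∧
          (∃ y y' : EuclideanSpace ℝ (Fin 3), ‖y‖ ≤ 1 ∧ ‖y'‖ ≤ 1 ∧ (4 : ℝ)⁻¹ ≤ ‖W y - W y'‖) ∧
          K * ν ≤ L * V ∧
          (∀ y : EuclideanSpace ℝ (Fin 3), ‖y‖ ≤ K →
            ‖V⁻¹ • Q.symm (u t (x₀ + L • Q y)) - W y‖ ≤ K⁻¹) ∧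
          (T - t) * V ≤ K * L := by
  obtain ⟨R, t₁, ht₁0, ht₁T, hceil⟩ := eulerCeiling_of_late_columnarWitness hν hT hmax hLH hdec
  refine ⟨R, t₁, ht₁0, ht₁T, ?_⟩
  rintro t ht ⟨x, hx⟩ K hK ⟨x₀, L, V, Q, W, hL, hV, hcol, hbd, hnear, -, -, hclose, hlate⟩
  have h := hceil t ht K hK x₀ L V Q W hL hV hcol hbd hnear hclose hlate
  have hTt : 0 ≤ T - t := (sub_pos.2 ht.2).le
  have hVx : (T - t) * ‖u t x‖ ≤ (T - t) * V := mul_le_mul_of_nonneg_left (hbd x) hTt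
  linarith

end ColumnarCoreExtent

end Summit.NavierStokesRegularity.NavierStokesRegularity.Theorems

end
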